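import Summits.QuantumFields.YangMills.Theorems.FluctuationComparisonRegPrIntLS2BetaRelativeMemberLetters
import HarnessLib

/-!
# S2β · letter (D♮)∕(D-stage) REL-TEL, the (C)-half — THE RELATIVE MAIN TERM IN LOG CURRENCY, BACKGROUND-PRICED (px12 g24 ‼ 13:07:55Z FINDING: the two-tower
# fixed point closes depth-uniformly only if the SIZE that multiplies the relative bond deviations is the BACKGROUND's plaquette size — BKG-tower — not the history's threshold)

Cell `ym3-torus` (rung R3 = continuum `SU(2)` Yang–Mills on the three-torus — NOT d = 4, NOT infinite volume, NOT a mass gap, NOT Clay).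
Width seat «width 10» `ym3-torus-px10` (gen 23), FREE px helper on crux `stmt-QuantumFields-20520`, count-neutral, DEFINITION-FREE; own-risk brick of the px10 lane «(C)-half of
letter (D♮)» (UV3-NODE §82).  The θ₀-edition of ✓`…RelativeMemberLetters.mean_norm_mlog_conjRect_sub_le`: the FIELD `U` is `PlaqSmall θ` (history threshold — it enters only the
`log`-Lipschitz factor `1 + 2L²θ`, i.e. the MAIN coefficient), the BACKGROUND `U₀` is `PlaqSmall θ₀` (BKG size — it prices EVERY junk term): the relative conjugate square is read
from the background side (`δ(S□S⁻¹) ≤ δ(□) + 2·dist1(□₀)·δ(S)`, ✓`dist1_rel_conj_le'` at `ℓ := □₀` + `dist1_rel_comm`), and ✓BRICK 2's local tent-kernel bound is run on the swapped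
pair `(U₀, U)` (its comb defect `4L³θ₀γ` then carries `θ₀`; `δ_p` and `dev` are symmetric).
★★ `mean_norm_mlog_conjRect_sub_le_bkg`: `|Idx|⁻¹·Σ_i ‖log(S_i□_iS_i⁻¹)(U) − log(S_i□_iS_i⁻¹)(U₀)‖ ≤ (1 + 2L²θ)·(Σ_p K Q p·δ_p + 4L³θ₀·γ + 2L²θ₀·β)`.

HONEST SCOPE.  Bookkeeping over landed letters; nothing of Bałaban's asserted; the BKG-priced relative (C)-step, the BKG-tower letter (the averaged argmin's plaquettes at every
level), (D-stage), GAP♯∘ (`stub_uniformFibreGapOrbit`), S2β, crux 20520 and `YM3TorusSU2` are NOT proved; no registered stub is closed; the Yang–Mills mass gap is NOT proved.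
Sorry-free, axioms standard.
References: T. Bałaban, CMP **98** (1985) 17–51 [Balaban1985Averaging] ((19), (21) p.21); CMP **102** (1985) 277–309 [Balaban1985Variational] (Thm 1 (9)–(10) p.279 — the
background's plaquette size).
-/

set_option autoImplicit false

noncomputable section

namespace Summit.QuantumFields.YangMills.Theorems.FluctuationComparisonRegPrIntLS2BetaRelativeMainTermBkg

open NormedSpace Finset
open scoped BigOperators Matrix.Norms.L2Operator
open Literature.MathematicalPhysics.QuantumFieldTheory.Balaban1983to89
open Literature.MathematicalPhysics.QuantumFieldTheory.Balaban1983to89.T4Continuum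
open Literature.MathematicalPhysics.QuantumFieldTheory.Balaban1983to89.BlockAveraging
open Literature.MathematicalPhysics.QuantumFieldTheory.Balaban1983to89.MatrixLog (mlog)
open Literature.MathematicalPhysics.QuantumFieldTheory.Balaban1983to89.T4TiltOscillation (bdev)
open Literature.MathematicalPhysics.QuantumFieldTheory.Balaban1983to89.T4ExpWindowSmallField (dist1_bdev_comm)
open B10Eq47AxialChi (shiftN rect)
open Summit.QuantumFields.YangMills.Theorems.FluctuationComparisonRegPrIntLS2BetaRelativeStokes (dist1_rel_comm dist1_comm_le_SU)
open Summit.QuantumFields.YangMills.Theorems.FluctuationComparisonRegPrIntLS2BetaRelativeTentKernel (mean_dist1_rect_rel_le_tentKernel_of_local)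
open Summit.QuantumFields.YangMills.Theorems.FluctuationComparisonRegPrIntLS2BetaOneLevelStepLetters (dist1_rect_le_sq_mul)
open Summit.QuantumFields.YangMills.Theorems.FluctuationComparisonRegPrIntLS2BetaRelativeMemberLetters (norm_coe_sub_coe_eq_dist1_rel dist1_rel_conj_le')

variable {P : Params} {j : ℕ}
variable {n : Type*} [Fintype n] [DecidableEq n] [Nonempty n]

/-- ★★ **THE RELATIVE MAIN TERM IN LOG CURRENCY, BACKGROUND-PRICED** (`SU(N)`, standing range; `PlaqSmall θ U` with `L²θ ≤ 1∕2` for the `log`-Lipschitz factor, `PlaqSmall θ₀ U₀` for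
every junk term; relative staircase transports `δ(S_i) ≤ β`, forward-near bond deviations `≤ γ`):
`|Idx|⁻¹·Σ_i ‖log(S_i□_iS_i⁻¹)(U) − log(S_i□_iS_i⁻¹)(U₀)‖ ≤ (1 + 2L²θ)·(Σ_p K Q p·δ_p + 4L³θ₀·γ + 2L²θ₀·β)`. [cite: Balaban1985Averaging, (19) p.21] -/
theorem mean_norm_mlog_conjRect_sub_le_bkg (hj : j + 1 ≤ P.m + P.K) (U U₀ : GaugeField P j (Matrix.specialUnitaryGroup n ℂ)) {θ θ₀ : ℝ} (hθ00 : 0 ≤ θ₀)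
    (hLθ : (P.L : ℝ) ^ 2 * θ ≤ 1 / 2) (hθ₀θ : θ₀ ≤ θ) (hU : PlaqSmall θ U) (hU₀ : PlaqSmall θ₀ U₀) (Q : Plaq P (j + 1)) {β γ : ℝ}
    (hS : ∀ i : Idx P, dist1 ((holAt U₀ (walk (emb Q.src) (stairWord i.2.1 (off i.1))))⁻¹ * holAt U (walk (emb Q.src) (stairWord i.2.1 (off i.1)))) ≤ β)
    (hdev : ∀ c : PBond P j, (∀ κ, blockOf c.src κ = Q.src κ ∨ blockOf c.src κ = Q.src κ + 1) → dist1 (bdev U U₀ c) ≤ γ) :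
    ((Fintype.card (Idx P) : ℝ))⁻¹ * ∑ i : Idx P,
        ‖mlog ((holAt U (walk (emb Q.src) (stairWord i.2.1 (off i.1))) * rect U (Site.blockSite Q.src i.1) Q.μ Q.ν P.L P.L *
            (holAt U (walk (emb Q.src) (stairWord i.2.1 (off i.1))))⁻¹ : Matrix.specialUnitaryGroup n ℂ) : Matrix n n ℂ) -
          mlog ((holAt U₀ (walk (emb Q.src) (stairWord i.2.1 (off i.1))) * rect U₀ (Site.blockSite Q.src i.1) Q.μ Q.ν P.L P.L *
            (holAt U₀ (walk (emb Q.src) (stairWord i.2.1 (off i.1))))⁻¹ : Matrix.specialUnitaryGroup n ℂ) : Matrix n n ℂ)‖ ≤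
      (1 + 2 * ((P.L : ℝ) ^ 2 * θ)) *
        (∑ p : Plaq P j, ((P.L : ℝ) ^ P.d)⁻¹ * (((block Q.src).filter (fun x : Site P j => p.μ = Q.μ ∧ p.ν = Q.ν ∧
            ∃ a ∈ range P.L, ∃ b ∈ range P.L, p.src = shiftN (shiftN x Q.μ a) Q.ν b)).card : ℝ) *
            dist1 ((GaugeField.plaqHol U₀ p)⁻¹ * GaugeField.plaqHol U p) +
          4 * (P.L : ℝ) ^ 3 * θ₀ * γ + 2 * ((P.L : ℝ) ^ 2 * θ₀) * β) := by
  set s : ℝ := (P.L : ℝ) ^ 2 * θ with hs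
  set s₀ : ℝ := (P.L : ℝ) ^ 2 * θ₀ with hs₀
  have hθ0 : 0 ≤ θ := hθ00.trans hθ₀θ
  have hs0 : 0 ≤ s := by positivity
  have hs₀s : s₀ ≤ s := by rw [hs, hs₀]; exact mul_le_mul_of_nonneg_left hθ₀θ (by positivity)
  have hU₀θ : PlaqSmall θ U₀ := fun p => (hU₀ p).trans_le hθ₀θ
  -- per member: `log` Lipschitz (both squares within `s` of `1`), then the relative conjugate square read from the BACKGROUND side
  have hR : ∀ (V : GaugeField P j (Matrix.specialUnitaryGroup n ℂ)) (t : ℝ), PlaqSmall t V → ∀ i : Idx P,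
      dist1 (holAt V (walk (emb Q.src) (stairWord i.2.1 (off i.1))) * rect V (Site.blockSite Q.src i.1) Q.μ Q.ν P.L P.L *
        (holAt V (walk (emb Q.src) (stairWord i.2.1 (off i.1))))⁻¹) ≤ (P.L : ℝ) ^ 2 * t := fun V t hV i => by
    rw [GaugeGroup.dist1_conj]; exact dist1_rect_le_sq_mul V hV _ Q.hμν
  have hmem : ∀ i : Idx P,
      ‖mlog ((holAt U (walk (emb Q.src) (stairWord i.2.1 (off i.1))) * rect U (Site.blockSite Q.src i.1) Q.μ Q.ν P.L P.L *
            (holAt U (walk (emb Q.src) (stairWord i.2.1 (off i.1))))⁻¹ : Matrix.specialUnitaryGroup n ℂ) : Matrix n n ℂ) -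
          mlog ((holAt U₀ (walk (emb Q.src) (stairWord i.2.1 (off i.1))) * rect U₀ (Site.blockSite Q.src i.1) Q.μ Q.ν P.L P.L *
            (holAt U₀ (walk (emb Q.src) (stairWord i.2.1 (off i.1))))⁻¹ : Matrix.specialUnitaryGroup n ℂ) : Matrix n n ℂ)‖ ≤
        (1 + 2 * s) * (dist1 ((rect U₀ (Site.blockSite Q.src i.1) Q.μ Q.ν P.L P.L)⁻¹ * rect U (Site.blockSite Q.src i.1) Q.μ Q.ν P.L P.L) + 2 * s₀ * β) := by
    intro i
    have hX : _ ≤ s := hR U θ hU i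
    have hX₀ : _ ≤ s := hR U₀ θ hU₀θ i
    have hXn : ‖((holAt U (walk (emb Q.src) (stairWord i.2.1 (off i.1))) * rect U (Site.blockSite Q.src i.1) Q.μ Q.ν P.L P.L *
        (holAt U (walk (emb Q.src) (stairWord i.2.1 (off i.1))))⁻¹ : Matrix.specialUnitaryGroup n ℂ) : Matrix n n ℂ) - 1‖ ≤ s := by
      rw [← FederbushMean.dist1_SU_eq]; exact hX
    have hX₀n : ‖((holAt U₀ (walk (emb Q.src) (stairWord i.2.1 (off i.1))) * rect U₀ (Site.blockSite Q.src i.1) Q.μ Q.ν P.L P.L *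
        (holAt U₀ (walk (emb Q.src) (stairWord i.2.1 (off i.1))))⁻¹ : Matrix.specialUnitaryGroup n ℂ) : Matrix n n ℂ) - 1‖ ≤ s := by
      rw [← FederbushMean.dist1_SU_eq]; exact hX₀
    have hlog := FederbushMean.norm_mlog_sub_mlog_le (ρ := s) (by linarith) hXn hX₀n
    have hfac : 1 + s / (1 - s) ≤ 1 + 2 * s := by
      have h1 : 0 < 1 - s := by linarith
      rw [add_le_add_iff_left, div_le_iff₀ h1]; nlinarith
    rw [norm_coe_sub_coe_eq_dist1_rel] at hlog
    -- the conjugate square from the BACKGROUND side: `δ(X₀⁻¹X) = δ(X⁻¹X₀)`, conj letter with `ℓ := □₀` (size `≤ s₀`), `ℓ₀ := □`, transports swapped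
    have hsq₀ : dist1 (rect U₀ (Site.blockSite Q.src i.1) Q.μ Q.ν P.L P.L) ≤ s₀ := dist1_rect_le_sq_mul U₀ hU₀ _ Q.hμν
    have hS' : dist1 ((holAt U (walk (emb Q.src) (stairWord i.2.1 (off i.1))))⁻¹ * holAt U₀ (walk (emb Q.src) (stairWord i.2.1 (off i.1)))) ≤ β := by
      rw [dist1_rel_comm]; exact hS i
    have hconj := dist1_rel_conj_le' dist1_comm_le_SU (ℓ₀ := rect U (Site.blockSite Q.src i.1) Q.μ Q.ν P.L P.L)
      (T₀ := holAt U (walk (emb Q.src) (stairWord i.2.1 (off i.1)))) hsq₀ le_rfl hS'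
    rw [dist1_rel_comm] at hconj
    rw [dist1_rel_comm (rect U₀ _ _ _ _ _) (rect U _ _ _ _ _)] at hconj
    have hd0 : 0 ≤ dist1 ((holAt U₀ (walk (emb Q.src) (stairWord i.2.1 (off i.1))) * rect U₀ (Site.blockSite Q.src i.1) Q.μ Q.ν P.L P.L *
        (holAt U₀ (walk (emb Q.src) (stairWord i.2.1 (off i.1))))⁻¹)⁻¹ * (holAt U (walk (emb Q.src) (stairWord i.2.1 (off i.1))) *
          rect U (Site.blockSite Q.src i.1) Q.μ Q.ν P.L P.L * (holAt U (walk (emb Q.src) (stairWord i.2.1 (off i.1))))⁻¹)) := GaugeGroup.dist1_nonneg _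
    calc _ ≤ (1 + s / (1 - s)) * _ := hlog
      _ ≤ (1 + 2 * s) * _ := mul_le_mul_of_nonneg_right hfac hd0
      _ ≤ (1 + 2 * s) * (dist1 ((rect U₀ (Site.blockSite Q.src i.1) Q.μ Q.ν P.L P.L)⁻¹ * rect U (Site.blockSite Q.src i.1) Q.μ Q.ν P.L P.L) + 2 * s₀ * β) :=
          mul_le_mul_of_nonneg_left hconj (by linarith)
  -- the member mean: ✓BRICK 2 on the SWAPPED pair `(U₀, U)` (its comb defect then carries `θ₀`); `δ`, `dev` symmetric
  have hdev' : ∀ c : PBond P j, (∀ κ, blockOf c.src κ = Q.src κ ∨ blockOf c.src κ = Q.src κ + 1) → dist1 (bdev U₀ U c) ≤ γ := fun c hc => by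
    rw [dist1_bdev_comm]; exact hdev c hc
  have hK' := mean_dist1_rect_rel_le_tentKernel_of_local dist1_comm_le_SU hj U₀ U hθ00 (fun p => (hU₀ p).le) Q hdev'
  have hK : ((Fintype.card (Idx P) : ℝ))⁻¹ * ∑ i : Idx P, dist1 ((rect U₀ (Site.blockSite Q.src i.1) Q.μ Q.ν P.L P.L)⁻¹ * rect U (Site.blockSite Q.src i.1) Q.μ Q.ν P.L P.L) ≤
      ∑ p : Plaq P j, ((P.L : ℝ) ^ P.d)⁻¹ * (((block Q.src).filter (fun x : Site P j => p.μ = Q.μ ∧ p.ν = Q.ν ∧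
          ∃ a ∈ range P.L, ∃ b ∈ range P.L, p.src = shiftN (shiftN x Q.μ a) Q.ν b)).card : ℝ) * dist1 ((GaugeField.plaqHol U₀ p)⁻¹ * GaugeField.plaqHol U p) +
        4 * (P.L : ℝ) ^ 3 * θ₀ * γ := by
    have e1 : ∑ i : Idx P, dist1 ((rect U (Site.blockSite Q.src i.1) Q.μ Q.ν P.L P.L)⁻¹ * rect U₀ (Site.blockSite Q.src i.1) Q.μ Q.ν P.L P.L) =
        ∑ i : Idx P, dist1 ((rect U₀ (Site.blockSite Q.src i.1) Q.μ Q.ν P.L P.L)⁻¹ * rect U (Site.blockSite Q.src i.1) Q.μ Q.ν P.L P.L) :=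
      Finset.sum_congr rfl fun i _ => dist1_rel_comm _ _
    have e2 : ∑ p : Plaq P j, ((P.L : ℝ) ^ P.d)⁻¹ * (((block Q.src).filter (fun x : Site P j => p.μ = Q.μ ∧ p.ν = Q.ν ∧
          ∃ a ∈ range P.L, ∃ b ∈ range P.L, p.src = shiftN (shiftN x Q.μ a) Q.ν b)).card : ℝ) * dist1 ((GaugeField.plaqHol U p)⁻¹ * GaugeField.plaqHol U₀ p) =
        ∑ p : Plaq P j, ((P.L : ℝ) ^ P.d)⁻¹ * (((block Q.src).filter (fun x : Site P j => p.μ = Q.μ ∧ p.ν = Q.ν ∧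
          ∃ a ∈ range P.L, ∃ b ∈ range P.L, p.src = shiftN (shiftN x Q.μ a) Q.ν b)).card : ℝ) * dist1 ((GaugeField.plaqHol U₀ p)⁻¹ * GaugeField.plaqHol U p) :=
      Finset.sum_congr rfl fun p _ => by rw [dist1_rel_comm (GaugeField.plaqHol U₀ p) (GaugeField.plaqHol U p)]
    rw [e1, e2] at hK'
    exact hK'
  have hN : (0 : ℝ) < Fintype.card (Idx P) := Nat.cast_pos.mpr Fintype.card_pos
  calc ((Fintype.card (Idx P) : ℝ))⁻¹ * ∑ i : Idx P, _
      ≤ ((Fintype.card (Idx P) : ℝ))⁻¹ * ∑ i : Idx P,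
          (1 + 2 * s) * (dist1 ((rect U₀ (Site.blockSite Q.src i.1) Q.μ Q.ν P.L P.L)⁻¹ * rect U (Site.blockSite Q.src i.1) Q.μ Q.ν P.L P.L) + 2 * s₀ * β) :=
        mul_le_mul_of_nonneg_left (Finset.sum_le_sum fun i _ => hmem i) (inv_nonneg.mpr hN.le)
    _ = (1 + 2 * s) * (((Fintype.card (Idx P) : ℝ))⁻¹ * ∑ i : Idx P,
          dist1 ((rect U₀ (Site.blockSite Q.src i.1) Q.μ Q.ν P.L P.L)⁻¹ * rect U (Site.blockSite Q.src i.1) Q.μ Q.ν P.L P.L) + 2 * s₀ * β) := by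
        have hsum : ∑ i : Idx P, (1 + 2 * s) * (dist1 ((rect U₀ (Site.blockSite Q.src i.1) Q.μ Q.ν P.L P.L)⁻¹ * rect U (Site.blockSite Q.src i.1) Q.μ Q.ν P.L P.L) + 2 * s₀ * β) =
            (1 + 2 * s) * (∑ i : Idx P, dist1 ((rect U₀ (Site.blockSite Q.src i.1) Q.μ Q.ν P.L P.L)⁻¹ * rect U (Site.blockSite Q.src i.1) Q.μ Q.ν P.L P.L) +
              (Fintype.card (Idx P) : ℝ) * (2 * s₀ * β)) := by
          rw [← Finset.mul_sum, Finset.sum_add_distrib, Finset.sum_const, Finset.card_univ, nsmul_eq_mul]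
        rw [hsum]
        field_simp
    _ ≤ (1 + 2 * s) * (_ + 4 * (P.L : ℝ) ^ 3 * θ₀ * γ + 2 * s₀ * β) := by
        refine mul_le_mul_of_nonneg_left ?_ (by linarith)
        linarith [hK]

end Summit.QuantumFields.YangMills.Theorems.FluctuationComparisonRegPrIntLS2BetaRelativeMainTermBkg

end
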